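import Summits.AnomalousDissipation.AnomalousDissipation.Theorems.SolenoidalFractalHomogenisationLagrangianStepOneLevelGlueLowerFamily
import Summits.AnomalousDissipation.AnomalousDissipation.Theorems.SolenoidalFractalHomogenisationLagrangianStepOneLevelSplitDefs
import Summits.AnomalousDissipation.AnomalousDissipation.Theorems.SolenoidalFractalHomogenisationLagrangianRenormalisationStepExistsL
import Summits.AnomalousDissipation.AnomalousDissipation.Theorems.SolenoidalFractalHomogenisationLagrangianStepPartialSumLipschitz
import Literature.Analysis.FluidPDE.PassiveVectorTensorPropagatorDissipationFloor
import Literature.Analysis.FunctionSpaces.TorusHeatSmoothing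
import HarnessLib

/-!
# W3-E `stub_effectiveFrameEnergyL`, clause (i): the DISSIPATION FLOOR of the window propagator and of its adjoint
# (helper for K1L_D `stmt-AnomalousDissipation-27980`, line `onelevel-design`; v31 binders of split §4c)

Summits-side helper file (everything proved; no definitions, no named facts).  For the coarse propagator `Um` of the renormalised tensor
`kbar m • renormStep (Φ ν) (c/ν²) S` along `E.partialSum m` on `[0,1]` and every window `0 ≤ s ≤ s′ ≤ 1` of length `≤ 2·refresh(m+1)`:
for `T ∈ {Um s s′, (Um s s′)†}` and every `y ∈ L²`,
  `‖T y‖² ≤ ‖y‖² − ½ Σ'_{k'} min(1, a(m+1)·8π²|k'|²·lo·(ν + c/ν)/N(m+1)²·(s′−s))·|ŷ(k')|²`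
— clause (i) of the registered stub VERBATIM, under the v31 binder block (F-k3l-5: all-levels strain ceiling `θ(i+1) ≤ θ₁`; F-k3l-6:
quadratic separation `N_m² ≤ N_{m+1}` and `NearIso S lo hi`), with `θ₁ = θ₁(k, W, M, hM, c, Φ, lo, hi, β)`.  Assembly of: the scale-free window floor
`Torus.exists_window_dissipation_const` (two-weight Lyapunov method, Literature chain P1–P4 of this seat), the Lipschitz bound of the partial
sums under the ceiling (`lipschitz_partialSum_mul_window_le`, K3L distortion tower), the `NearIso` band of the window tensor
(`nearIso_renormStep`), and the rate identity `kbar m = a(m+1)(ν + c/ν)/N(m+1)²` (Taylor recursion of `Permissible` + `cellVisc`).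
Clauses (ii-out)/(ii-in) (band kill) are NOT in this file.  Infrastructure for route-1's rung leaf F-D1.A0 (a frontier FORMAL rung); NOT a
proof of anomalous dissipation.
-/

set_option linter.dupNamespace false

namespace Summit.AnomalousDissipation.AnomalousDissipation.Theorems.SolenoidalFractalHomogenisation.LagrangianStep

open Literature.Analysis Literature.Analysis.FluidPDE Literature.Analysis.FunctionSpaces
open MeasureTheory Set Filter Function
open scoped ENNReal NNReal InnerProductSpace
open Literature.Analysis.FluidPDE.LatticeShear
open Summit.AnomalousDissipation.AnomalousDissipation.Theorems.SolenoidalFractalHomogenisation.LagrangianCarrierConstruction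
  (lipschitz_partialSum_mul_window_le)
open Summit.AnomalousDissipation.AnomalousDissipation.Theorems.SolenoidalFractalHomogenisation.LagrangianRenormalisationStep
  (memLp_top_stLift_of_continuous continuous_uncurry_partialSum isWeaklyDivFree_partialSum)

noncomputable section

/-- **The rate identity**: `kbar m = a(m+1)·(ν + c/ν)/N(m+1)²`, `ν = cellVisc (m+1)`, `c = gain` (Taylor recursion of `Permissible` and the
definition of `cellVisc`). -/
theorem kbar_eq_rate {k : ℕ} (E : LagrangianLatticeCarrier k) (hP : E.toFractalCarrierData.Permissible) (m : ℕ) :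
    E.kbar m = E.a (m + 1) * (E.cellVisc (m + 1) + E.gain / E.cellVisc (m + 1)) / (E.N (m + 1) : ℝ) ^ 2 := by
  have hT := hP.2.2.2.1 m
  have hκ : 0 < E.kbar (m + 1) := E.kbar_pos (m + 1)
  have hN : (0 : ℝ) < E.N (m + 1) := by exact_mod_cast E.N_pos (m + 1)
  have ha : 0 < E.a (m + 1) := E.a_pos (m + 1)
  rw [hT]
  simp only [FractalCarrierData.cellVisc]
  field_simp

/-- `‖A† y‖ ≤ ‖y‖` for a contraction `A` of a Hilbert space. -/
theorem norm_adjoint_apply_le_of_norm_le {A : V2 →L[ℝ] V2} (hA : ∀ y, ‖A y‖ ≤ ‖y‖) (y : V2) :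
    ‖ContinuousLinearMap.adjoint A y‖ ≤ ‖y‖ := by
  have h1 : ‖A‖ ≤ 1 := ContinuousLinearMap.opNorm_le_bound _ zero_le_one fun y => by rw [one_mul]; exact hA y
  have h2 : ‖ContinuousLinearMap.adjoint A‖ = ‖A‖ := LinearIsometryEquiv.norm_map _ _
  calc ‖ContinuousLinearMap.adjoint A y‖ ≤ ‖ContinuousLinearMap.adjoint A‖ * ‖y‖ := ContinuousLinearMap.le_opNorm _ _
    _ ≤ 1 * ‖y‖ := by rw [h2]; exact mul_le_mul_of_nonneg_right h1 (norm_nonneg _)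
    _ = ‖y‖ := one_mul _

/-- **W3-E (i): THE DISSIPATION FLOOR of the window propagator and of its adjoint** (v31 binders; see the module docstring). -/
theorem effectiveFrameEnergyL_dissipation : ∀ k (W : Literature.Analysis.FluidPDE.LatticeShear.LatticeWord k) (M : ℝ) (hM : 0 < M)
    (c : ℝ), 0 < c →
    ∀ (Φ : ℝ → Torus.Visc4 (Fin 3) → Torus.Visc4 (Fin 3)) (lo hi β : ℝ), 0 < lo → lo ≤ 1 → 1 ≤ hi → 0 ≤ β →
      ∃ θ₁ > (0:ℝ),
        ∀ E : Literature.Analysis.FluidPDE.LatticeShear.LagrangianLatticeCarrier k, E.design = W.stretch M hM → E.gain = c →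
          E.LPermissible → E.Regular → (∀ i, E.θ (i + 1) ≤ θ₁) → (∀ m, E.N m ^ 2 ≤ E.N (m + 1)) →
        ∀ (m : ℕ),
        ∀ (S : Torus.Visc4 (Fin 3)), Torus.OddSmall S β → Torus.NearIso S lo hi →
          Torus.OddSmall (Φ (E.cellVisc (m + 1)) S) β → Torus.NearIso (Φ (E.cellVisc (m + 1)) S) lo hi →
        ∀ Um : ℝ → ℝ → (V2 →L[ℝ] V2),
          Torus.IsPropagator 1 (E.partialSum m) (E.kbar m • renormStep (Φ (E.cellVisc (m + 1))) (E.gain / E.cellVisc (m + 1) ^ 2) S) Um →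
        ∀ (s s' : ℝ), 0 ≤ s → s ≤ s' → s' ≤ 1 → s' - s ≤ 2 * E.refresh (m + 1) →
        ∀ T : V2 →L[ℝ] V2, (T = Um s s' ∨ T = ContinuousLinearMap.adjoint (Um s s')) →
          (∀ y : V2, ‖T y‖ ^ 2 ≤ ‖y‖ ^ 2 - 1 / 2 * ∑' k' : Fin 3 → ℤ,
              min 1 (E.a (m + 1) * (8 * Real.pi ^ 2 * ‖Torus.latticeVec k'‖ ^ 2 * lo * (E.cellVisc (m + 1) + c / E.cellVisc (m + 1))
                / (E.N (m + 1) : ℝ) ^ 2) * (s' - s))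
              * ‖UnitAddTorus.mFourierCoeff (EuclideanSpace.complexify ∘ ⇑y) k'‖ ^ 2) := by
  intro k W M hM c hc Φ lo hi β hlo hlo1 hhi hβ
  obtain ⟨c₀, hc₀, hfloor⟩ := Torus.exists_window_dissipation_const (Fin 3)
  obtain ⟨θs, hθs, CL, hCL, hLip⟩ := lipschitz_partialSum_mul_window_le k (W.stretch M hM)
  refine ⟨min θs (c₀ / (2 * CL + 1)), lt_min hθs (by positivity), ?_⟩
  intro E hdes hgain hLP hReg hθ hsq m S hS₁ hS₂ hS₃ hS₄ Um hUm s s' hs hss' hs'1 hlen T hT y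
  have hP := hLP.permissible
  have hLR := hReg.levelRegular
  -- the rate in the two currencies
  have hrate : ∀ k' : Fin 3 → ℤ, E.a (m + 1) * (8 * Real.pi ^ 2 * ‖Torus.latticeVec k'‖ ^ 2 * lo *
      (E.cellVisc (m + 1) + c / E.cellVisc (m + 1)) / (E.N (m + 1) : ℝ) ^ 2) * (s' - s) =
      8 * Real.pi ^ 2 * (E.kbar m * lo) * Torus.freqNormSq k' * (s' - s) := by
    intro k'
    rw [Torus.norm_latticeVec_sq, kbar_eq_rate E hP m, hgain]
    ring
  have htsum : ∑' k' : Fin 3 → ℤ, min 1 (E.a (m + 1) * (8 * Real.pi ^ 2 * ‖Torus.latticeVec k'‖ ^ 2 * lo *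
        (E.cellVisc (m + 1) + c / E.cellVisc (m + 1)) / (E.N (m + 1) : ℝ) ^ 2) * (s' - s)) *
        ‖UnitAddTorus.mFourierCoeff (EuclideanSpace.complexify ∘ ⇑y) k'‖ ^ 2 =
      ∑' k' : Fin 3 → ℤ, min 1 (8 * Real.pi ^ 2 * (E.kbar m * lo) * Torus.freqNormSq k' * (s' - s)) *
        ‖UnitAddTorus.mFourierCoeff (EuclideanSpace.complexify ∘ ⇑y) k'‖ ^ 2 :=
    tsum_congr fun k' => by rw [hrate k']
  rw [htsum]
  rcases hss'.eq_or_lt with hEq | hlt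
  · -- degenerate window: the floor is `‖y‖²`, and `T` is a contraction
    subst hEq
    have h0 : ∑' k' : Fin 3 → ℤ, min 1 (8 * Real.pi ^ 2 * (E.kbar m * lo) * Torus.freqNormSq k' * (s - s)) *
        ‖UnitAddTorus.mFourierCoeff (EuclideanSpace.complexify ∘ ⇑y) k'‖ ^ 2 = 0 := by
      simp
    rw [h0, mul_zero, sub_zero]
    have hTy : ‖T y‖ ≤ ‖y‖ := by
      rcases hT with rfl | rfl
      · exact hUm.norm_le s s y
      · exact norm_adjoint_apply_le_of_norm_le (fun y => hUm.norm_le s s y) y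
    exact pow_le_pow_left₀ (norm_nonneg _) hTy 2
  · -- a genuine window: the scale-free floor
    have hcont : Continuous (uncurry (E.partialSum m)) :=
      continuous_uncurry_partialSum E m fun i _ => hLR.continuous_uncurry_b i
    have hb := memLp_top_stLift_of_continuous hcont 1
    have hbdiv : ∀ᵐ τ ∂(volume.restrict (Ioo (0:ℝ) 1)), Torus.IsWeaklyDivFree (E.partialSum m τ) :=
      ae_of_all _ fun τ => isWeaklyDivFree_partialSum E m (fun i _ => hLR.continuous_uncurry_b i)
        (fun i _ t => hLR.isWeaklyDivFree_b i t) τ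
    have hbc : ∀ᵐ τ ∂(volume.restrict (Ioo (0:ℝ) 1)), Continuous (E.partialSum m τ) :=
      ae_of_all _ fun τ => hcont.comp (Continuous.prodMk_right τ)
    have hθ₀ : ∀ i, E.θ (i + 1) ≤ min θs (c₀ / (2 * CL + 1)) := hθ
    obtain ⟨hL, hwinL⟩ := hLip E (min θs (c₀ / (2 * CL + 1))) hdes (min_le_left _ _) hLP hReg hsq hθ₀ m
    set L : ℝ := CL * ∑ i ∈ Finset.range m, E.a (i + 1) with hLdef
    have hL0 : 0 ≤ L := mul_nonneg hCL (Finset.sum_nonneg fun i _ => (E.a_pos _).le)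
    have hbL : ∀ᵐ τ ∂(volume.restrict (Ioo (0:ℝ) 1)), ∀ x y : UnitAddTorus (Fin 3),
        ‖E.partialSum m τ x - E.partialSum m τ y‖ ≤ L * ‖Torus.reprc (x - y)‖ :=
      ae_of_all _ fun τ x y => hL τ x y
    have hwin : L * (s' - s) ≤ c₀ := by
      have h1 : L * (s' - s) ≤ 2 * CL * E.θ (m + 1) := hwinL s s' hlen
      have h2 : E.θ (m + 1) ≤ c₀ / (2 * CL + 1) := (hθ m).trans (min_le_right _ _)
      have h3 : 2 * CL * E.θ (m + 1) ≤ 2 * CL * (c₀ / (2 * CL + 1)) := mul_le_mul_of_nonneg_left h2 (by positivity)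
      have h4 : 2 * CL * (c₀ / (2 * CL + 1)) ≤ c₀ := by
        rw [mul_div_assoc']
        exact (div_le_iff₀ (by positivity)).2 (by nlinarith)
      linarith
    -- the tensor band
    have hg0 : 0 ≤ E.gain / E.cellVisc (m + 1) ^ 2 := div_nonneg (hgain ▸ hc.le) (sq_nonneg _)
    have h𝔸 : Torus.NearIso (E.kbar m • renormStep (Φ (E.cellVisc (m + 1))) (E.gain / E.cellVisc (m + 1) ^ 2) S)
        (E.kbar m * lo) (E.kbar m * hi) :=
      (nearIso_renormStep hg0 hS₂ hS₄).smul (E.kbar_pos m).le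
    have hklo : 0 < E.kbar m * lo := mul_pos (E.kbar_pos m) hlo
    obtain ⟨hfwd, hadj⟩ := hfloor hUm h𝔸 hklo hb hbdiv hbc hL0 hbL hs hlt hs'1 hwin y
    rcases hT with rfl | rfl
    · exact hfwd
    · exact hadj

end

end Summit.AnomalousDissipation.AnomalousDissipation.Theorems.SolenoidalFractalHomogenisation.LagrangianStep
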